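import Summits.Ventures.PackingBounds.ThreePointCert.CheckExact

/-!
# Exact three-point certificates: row-bucketed block corrections (fast `Srows` for dependent rows)

Framing: lottery ticket; floor = certified bounds/negative ranges. Venture `PackingBounds`
(cell `pub-packcert`), three-point SDP family, exact (slack-free) kernel format of
`ThreePointCert.CheckExact`.

`CheckExact.Sent p i j` reads the sparse symmetric correction `Δ` of a face block by scanning the
WHOLE list `p.delta` (`deltaEnt`, `|Δ|` steps per entry).  A LEAD row `j < f` of a part needs only
row `j` of `S` (`f·|Δ|` steps), but a DEPENDENT row `j ≥ f` needs every entry of `S`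
(`Wrow = Σ_a C_a S_a` via `combRows`), i.e. `f²·|Δ|` steps — `52² · 1378 ≈ 3.7·10⁶` list visits (plus
`List.sum` chains of depth `|Δ|`) for the degree-8 part `pR0std` of recog's `G121n56` chain, which does
not finish inside the gate's elaboration cap although the arithmetic is tiny.

This file gives the SAME programs with the corrections bucketed by row first:
`deltaRow i Δ` (one pass over `Δ` per row) and `deltaSum i j (deltaRow i Δ) = deltaEnt Δ i j`
(`deltaSum_deltaRow`), so all of `S` costs `f·|Δ| + f²·(row bucket)` steps.  `SrowsD = Srows`
(`SrowsD_eq`), `partRowsD = partRows`, `partChunkOKD = partChunkOK` (`partChunkOKD_eq`) are proved as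
program equalities, so a row file may check `partChunkOKD … = true` by `decide` and the proof file uses
`SoundExactParts.pchunkVal_of_ok … (partChunkOKD_eq … ▸ h)` (or rewrites with `partChunkOKD_eq`)
with every other file unchanged.  Lead rows are unaffected in meaning and get cheaper too.
-/

noncomputable section

namespace Summit.Ventures.PackingBounds.ThreePointCert

open Literature.Geometry.DiscreteGeometry Literature.Geometry.DiscreteGeometry.PolyCert
open Literature.Geometry.DiscreteGeometry.PolyCert.SPoly

/-! ### Row buckets of the sparse correction -/

/-- The corrections `(a, b, v)` touching row `i` (`a = i` or `b = i`), in list order (one `List.rec` pass). -/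
def deltaRow (i : ℕ) (dl : List (ℕ × ℕ × ℤ)) : List (ℕ × ℕ × ℤ) :=
  dl.rec (motive := fun _ => List (ℕ × ℕ × ℤ)) []
    (fun e _ ih => cond (Nat.beq e.1 i || Nat.beq e.2.1 i) (e :: ih) ih)

/-- `Σ v` over the corrections `(a, b, v)` with `{a, b} = {i, j}` (ordered test as in `deltaEnt`), one pass. -/
def deltaSum (i j : ℕ) (dl : List (ℕ × ℕ × ℤ)) : ℤ :=
  dl.rec (motive := fun _ => ℤ) 0
    (fun e _ ih => cond ((Nat.beq e.1 i && Nat.beq e.2.1 j) || (Nat.beq e.1 j && Nat.beq e.2.1 i)) (e.2.2 + ih) ih)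

/-- `deltaRow` on the empty list. -/
@[simp] theorem deltaRow_nil (i : ℕ) : deltaRow i [] = [] := rfl

/-- `deltaRow` unfolded one step. -/
@[simp] theorem deltaRow_cons (i : ℕ) (e : ℕ × ℕ × ℤ) (dl : List (ℕ × ℕ × ℤ)) :
    deltaRow i (e :: dl) = cond (Nat.beq e.1 i || Nat.beq e.2.1 i) (e :: deltaRow i dl) (deltaRow i dl) := rfl

/-- `deltaSum` on the empty list. -/
@[simp] theorem deltaSum_nil (i j : ℕ) : deltaSum i j [] = 0 := rfl

/-- `deltaSum` unfolded one step. -/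
@[simp] theorem deltaSum_cons (i j : ℕ) (e : ℕ × ℕ × ℤ) (dl : List (ℕ × ℕ × ℤ)) :
    deltaSum i j (e :: dl) =
      cond ((Nat.beq e.1 i && Nat.beq e.2.1 j) || (Nat.beq e.1 j && Nat.beq e.2.1 i)) (e.2.2 + deltaSum i j dl)
        (deltaSum i j dl) := rfl

/-- `deltaEnt` unfolded one step. -/
private theorem deltaEnt_cons' (e : ℕ × ℕ × ℤ) (dl : List (ℕ × ℕ × ℤ)) (i j : ℕ) :
    deltaEnt (e :: dl) i j =
      (if (e.1 = i ∧ e.2.1 = j) ∨ (e.1 = j ∧ e.2.1 = i) then e.2.2 else 0) + deltaEnt dl i j := by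
  simp [deltaEnt]

/-- `Nat.beq` is the decision of `=`. -/
private theorem beq_eq_decide (a b : ℕ) : Nat.beq a b = decide (a = b) := by
  cases h : Nat.beq a b
  · exact (decide_eq_false (Nat.ne_of_beq_eq_false h)).symm
  · exact (decide_eq_true (Nat.eq_of_beq_eq_true h)).symm

/-- The Boolean index test of `deltaSum` is the decision of the proposition tested by `deltaEnt`. -/
private theorem test_eq_decide (a b i j : ℕ) :
    ((Nat.beq a i && Nat.beq b j) || (Nat.beq a j && Nat.beq b i)) =
      decide ((a = i ∧ b = j) ∨ (a = j ∧ b = i)) := by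
  by_cases h1 : a = i <;> by_cases h2 : b = j <;> by_cases h3 : a = j <;> by_cases h4 : b = i <;>
    simp [beq_eq_decide, h1, h2, h3, h4]

/-- The one-pass sum agrees with `deltaEnt`. -/
theorem deltaSum_eq (i j : ℕ) (dl : List (ℕ × ℕ × ℤ)) : deltaSum i j dl = deltaEnt dl i j := by
  induction dl with
  | nil => simp [deltaEnt]
  | cons e dl ih =>
    rw [deltaSum_cons, deltaEnt_cons', ih, test_eq_decide]
    by_cases h : (e.1 = i ∧ e.2.1 = j) ∨ (e.1 = j ∧ e.2.1 = i)
    · rw [decide_eq_true h, cond_true, if_pos h]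
    · rw [decide_eq_false h, cond_false, if_neg h, zero_add]

/-- Bucketing by row `i` does not change the `(i, j)` sums. -/
theorem deltaSum_deltaRow (i j : ℕ) (dl : List (ℕ × ℕ × ℤ)) :
    deltaSum i j (deltaRow i dl) = deltaEnt dl i j := by
  induction dl with
  | nil => simp [deltaEnt]
  | cons e dl ih =>
    rw [deltaRow_cons, deltaEnt_cons']
    by_cases hrow : (Nat.beq e.1 i || Nat.beq e.2.1 i) = true
    · rw [hrow, cond_true, deltaSum_cons, ih, test_eq_decide]
      by_cases h : (e.1 = i ∧ e.2.1 = j) ∨ (e.1 = j ∧ e.2.1 = i)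
      · rw [decide_eq_true h, cond_true, if_pos h]
      · rw [decide_eq_false h, cond_false, if_neg h, zero_add]
    · rw [eq_false_of_ne_true hrow, cond_false, ih]
      have h1 : e.1 ≠ i := fun h => hrow (by simp [beq_eq_decide, h])
      have h2 : e.2.1 ≠ i := fun h => hrow (by simp [beq_eq_decide, h])
      have hP : ¬ ((e.1 = i ∧ e.2.1 = j) ∨ (e.1 = j ∧ e.2.1 = i)) := by
        rintro (⟨h, -⟩ | ⟨-, h⟩)
        · exact h1 h
        · exact h2 h
      rw [if_neg hP, zero_add]

/-! ### `S` with bucketed corrections -/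

/-- Row `i` of `S = cmu·I + L Lᵀ + Δ`, the corrections of row `i` bucketed once, row `i` of `L` read once. -/
def SrowD (p : PSDBlk) (i : ℕ) : List ℤ :=
  let di := deltaRow i p.delta
  let Li := getRowN p.L i
  (List.range p.f).map fun j =>
    (if i = j then (p.cmu : ℤ) else 0) + dotNZ p.B p.BB Li (getRowN p.L j) 0 0 + deltaSum i j di

/-- The rows of `S` (`= Srows p`, see `SrowsD_eq`). -/
def SrowsD (p : PSDBlk) : List (List ℤ) := (List.range p.f).map fun i => SrowD p i

/-- `SrowsD` is `Srows`. -/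
theorem SrowsD_eq (p : PSDBlk) : SrowsD p = Srows p := by
  unfold SrowsD SrowD Srows Sent
  simp only [deltaSum_deltaRow]

/-! ### Parts of `(ii)` over the bucketed `S` -/

/-- Row `j` of `M = V S Vᵀ`, the row `W_j = (V S)_j` computed once (`= Mrow`, by `rfl`). -/
def MrowD (V : Lift) (S : List (List ℤ)) (f j : ℕ) : List ℤ :=
  let w := Wrow V S f j
  List.zipWith (· * ·) w V.lv ++ V.C.map fun ci => dotZ ci w 0

/-- `MrowD` is `Mrow` (definitionally). -/
theorem MrowD_eq (V : Lift) (S : List (List ℤ)) (f j : ℕ) : MrowD V S f j = Mrow V S f j := rfl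

/-- The polynomial of row `j` (`= rowPolyX`, by `rfl`). -/
def rowPolyXD (P : SymPart) (S : List (List ℤ)) (j : ℕ) : SPoly :=
  let Mj := MrowD P.V S P.psd.f j
  let one := mulN (P.bs.getD j []) (linComb Mj P.bs)
  if P.two then
    mergeAll [smul 3 one, mulN (P.bs2.getD j []) (linComb Mj P.bs2)]
  else one

/-- `rowPolyXD` is `rowPolyX` (definitionally). -/
theorem rowPolyXD_eq (P : SymPart) (S : List (List ℤ)) (j : ℕ) : rowPolyXD P S j = rowPolyX P S j := rfl

/-- Rows `j0, …, j0+cnt-1` of a part over the bucketed `S`. -/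
def partRowsD (P : SymPart) (j0 cnt : ℕ) : SPoly :=
  let S := SrowsD P.psd
  mergeAllB 16 ((List.range cnt).map fun i => rowPolyXD P S (j0 + i))

/-- `partRowsD` is `partRows`. -/
theorem partRowsD_eq (P : SymPart) (j0 cnt : ℕ) : partRowsD P j0 cnt = partRows P j0 cnt := by
  show mergeAllB 16 ((List.range cnt).map fun i => rowPolyXD P (SrowsD P.psd) (j0 + i)) =
    mergeAllB 16 ((List.range cnt).map fun i => rowPolyX P (Srows P.psd) (j0 + i))
  rw [SrowsD_eq]; rfl

/-- Chunk check of a part over the bucketed `S`: `Dprev + rows [j0, j0+cnt) - Dnext ≡ 0`. -/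
def partChunkOKD (P : SymPart) (j0 cnt : ℕ) (Dprev Dnext : SPoly) : Bool :=
  decide (j0 + cnt ≤ P.V.m) && allZero (mergeAll [Dprev, partRowsD P j0 cnt, neg Dnext])

/-- `partChunkOKD` is `partChunkOK`: a row file may prove `partChunkOKD … = true` by `decide` and the
proof file feeds `(partChunkOKD_eq …) ▸ h` to `SoundExactParts.pchunkVal_of_ok`. -/
theorem partChunkOKD_eq (P : SymPart) (j0 cnt : ℕ) (Dprev Dnext : SPoly) :
    partChunkOKD P j0 cnt Dprev Dnext = partChunkOK P j0 cnt Dprev Dnext := by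
  unfold partChunkOKD partChunkOK
  rw [partRowsD_eq]

/-- Transfer: a `partChunkOKD` check is a `partChunkOK` check. -/
theorem partChunkOK_of_D (P : SymPart) (j0 cnt : ℕ) (Dprev Dnext : SPoly)
    (h : partChunkOKD P j0 cnt Dprev Dnext = true) : partChunkOK P j0 cnt Dprev Dnext = true := by
  rw [← partChunkOKD_eq]; exact h

end Summit.Ventures.PackingBounds.ThreePointCert

end
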